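import Summits.QuantumFields.YangMills.Theorems.ParabolicTrajectoryContinuumLimitOnTrajectoryUclVarA
import Summits.QuantumFields.YangMills.Theorems.ParabolicTrajectoryContinuumLimitOnTrajectoryUclVarB
import Summits.QuantumFields.YangMills.Theorems.ParabolicTrajectoryContinuumLimitOnTrajectoryStubArpC
import Summits.QuantumFields.YangMills.Theorems.ParabolicTrajectoryContinuumLimitOnTrajectoryUclSums
import Summits.QuantumFields.YangMills.Theorems.ParabolicTrajectoryContinuumLimitOnTrajectoryUclRot
import Literature.MathematicalPhysics.QuantumFieldTheory.OSVectorNormGrowth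

/-!
# Crux `ContinuumLimitOnTrajectory` (stmt-QuantumFields-10522), line `two-orbit-synchronisation` (seat c2):
# plaquette-string terms of the reflected pairing — main terms by `UUVB`, Taylor remainders by counting
# (helper of `varBound_of_uuvb`, part C)

Helper file (`--supports stmt-QuantumFields-10522`) of wave-2 worker W2-VAR for the registered stub
`stub_uclOfGap : UCLOfGap`; continues …UclVarA/B. After the reflection identity (`Var.pairing_planeRefl_eq`) and worker
A's `6^p`-term expansions (`Arp.lat_curvature_expand`, `Arp.lat_curvature_cfgReflect_expand`, …StubArpC) the reflected
self-pairing is a sum over pairs of plaquette strings `(q, q')` of `∫ lat (Ṽ∘q) F · lat (Ṽ∘q') (shiftTest q' G) dμ_k`, the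
test function of the reflected factor being translated by `a_k e₀` in the ELECTRIC slots of `q'` only — which does not keep
it off-diagonal. Taylor-expanding `shiftTest q' G = G(· − c)` along `−c` (…UclVarB) splits each term into
* MAIN TERMS `∫ lat (Ṽ∘q) F · lat (Ṽ∘q') ((∂_{−c})^[n] G) dμ_k = canonDistribution (q ++ q') (F ⊗ (∂_{−c})^[n] G)`
  (`Var.integral_latVq_mul_eq_canon`), whose test functions ARE off-diagonal when `F`, `G` avoid their loci and are
  separated by a predicate on the time coordinate (`Var.isOffDiagonal_appendTensor_iterate`), hence bounded by the
  uniform-threshold bound `UUVB` at step `k` (`Var.norm_main_le`);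
* a REMAINDER `∫ lat (Ṽ∘q) F · lat (Ṽ∘q') (G(· − c) − Taylor polynomial) dμ_k` bounded by sup norms — bounded plaquettes
  (`Var.exists_plaq_bound`, `Var.norm_lat_le`) and lattice Riemann sums (`…UclSums`, `Var.sum_box_norm_le_of_decay`,
  `Var.sum_norm_taylorRem_le`, `Var.norm_integral_latVq_mul_le`): `a_k^{−8p}` from counting against `a_k^N` from the remainder
  (`N = 8p` in part D).
Everything new is in the sub-namespace `Var`; no new definitions, no notation.
-/

set_option autoImplicit false

open scoped SchwartzMap ComplexConjugate
open MeasureTheory Filter Topology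
open Literature.MathematicalPhysics.QuantumFieldTheory Literature.MathematicalPhysics.QuantumLattice
open Literature.MathematicalPhysics.AQFT Literature.Probability.LatticeModels

noncomputable section

namespace Summit.QuantumFields.YangMills.Cruxes.ContinuumLimitOnTrajectory.TwoOrbitSynchronisation

namespace Var

/-! ## Off-diagonality of separated tensors -/

section Sep

variable {n m : ℕ}

/-- **Separated locus-avoiding factors have a locus-avoiding tensor product** (predicate form of …UclRot's
`avoidsLocus_appendTensor_of_sep`): if the values of the coordinate `crd` satisfy `P` on the support of `F` and `¬ P` on
the support of `G'`, then `F ⊗ G'` avoids the locus of `n + m` points. -/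
theorem avoidsLocus_appendTensor_of_pred {F : 𝓢((Fin n → EuclideanSpace ℝ (Fin 4)), ℂ)} {G' : 𝓢((Fin m → EuclideanSpace ℝ (Fin 4)), ℂ)} (hF : AvoidsLocus F)
    (hG : AvoidsLocus G') (crd : Fin 4) (P : ℝ → Prop)
    (hFc : tsupport (F : (Fin n → EuclideanSpace ℝ (Fin 4)) → ℂ) ⊆ {x | ∀ j, P (x j crd)})
    (hGc : tsupport (G' : (Fin m → EuclideanSpace ℝ (Fin 4)) → ℂ) ⊆ {y | ∀ j, ¬ P (y j crd)}) : AvoidsLocus (F.appendTensor G') := by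
  -- adapted from …UclRot (`avoidsLocus_appendTensor_of_sep`)
  intro x hx hxl
  obtain ⟨h1, h2⟩ := tsupport_appendTensor_subset_preimage F G' hx
  obtain ⟨i, j, hij, hxij⟩ := hxl
  induction i using Fin.addCases with
  | left i =>
    induction j using Fin.addCases with
    | left j =>
      refine hF h1 ⟨i, j, fun h => hij (by rw [h]), ?_⟩
      simpa [Function.comp_def] using hxij
    | right j =>
      have a1 := hFc h1 i
      have a2 := hGc h2 j
      simp only [Function.comp_apply] at a1 a2
      rw [hxij] at a1
      exact a2 a1
  | right i =>
    induction j using Fin.addCases with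
    | left j =>
      have a1 := hGc h2 i
      have a2 := hFc h1 j
      simp only [Function.comp_apply] at a1 a2
      rw [hxij] at a1
      exact a1 a2
    | right j =>
      refine hG h2 ⟨i, j, fun h => hij (by rw [h]), ?_⟩
      simpa [Function.comp_def] using hxij

/-- **The main-term test functions are off-diagonal**: `F ⊗ (∂_v)^[l] H ∈ ⁰𝒮` when `F`, `H` avoid their loci and the time
coordinates of their supports are separated by a predicate. -/
theorem isOffDiagonal_appendTensor_iterate {F : 𝓢((Fin n → EuclideanSpace ℝ (Fin 4)), ℂ)} {H : 𝓢((Fin m → EuclideanSpace ℝ (Fin 4)), ℂ)} (hF : AvoidsLocus F)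
    (hH : AvoidsLocus H) (P : ℝ → Prop) (hFP : tsupport (F : (Fin n → EuclideanSpace ℝ (Fin 4)) → ℂ) ⊆ {x | ∀ j, P (x j 0)})
    (hHP : tsupport (H : (Fin m → EuclideanSpace ℝ (Fin 4)) → ℂ) ⊆ {y | ∀ j, ¬ P (y j 0)}) (v : Fin m → EuclideanSpace ℝ (Fin 4)) (l : ℕ) :
    IsOffDiagonal (F.appendTensor ((LineDeriv.lineDerivOp v)^[l] H)) :=
  (avoidsLocus_appendTensor_of_pred hF (hH.of_tsupport_subset (tsupport_iterate_lineDerivOp_subset v l H)) 0 P hFP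
    ((tsupport_iterate_lineDerivOp_subset v l H).trans hHP)).isOffDiagonal

end Sep

/-! ## Uniform bounds on the centred plaquettes; sup bounds of lattice functionals -/

section Plaq

variable {G : Type} [Group G] [TopologicalSpace G] [IsTopologicalGroup G] [CompactSpace G]
  [MeasurableSpace G] [BorelSpace G]

/-- **A uniform bound on the six single-plaquette species.** -/
theorem exists_plaq_bound (r : LatticeRep G) : ∃ B : ℝ, 0 ≤ B ∧ ∀ (q : PlaqIdx) (V : LGConfig 4 G), |(plaq r q).F V| ≤ B := by
  have h0 : ∀ q : PlaqIdx, 0 ≤ Classical.choose (plaq r q).bounded := fun q =>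
    (abs_nonneg _).trans (Classical.choose_spec (plaq r q).bounded fun _ => 1)
  refine ⟨∑ q : PlaqIdx, Classical.choose (plaq r q).bounded, Finset.sum_nonneg fun q _ => h0 q, fun q V => ?_⟩
  exact (Classical.choose_spec (plaq r q).bounded V).trans (Finset.single_le_sum (fun q' _ => h0 q') (Finset.mem_univ q))

/-- The torus means of the plaquette species obey the same bound, uniformly in the step. -/
theorem abs_mean_plaq_le (r : LatticeRep G) {B : ℝ} (hB : ∀ (q : PlaqIdx) (V : LGConfig 4 G), |(plaq r q).F V| ≤ B)
    (β : ℝ) (L : ℕ) (q : PlaqIdx) : |wilsonTorusMean r.ρ β L (plaq r q).F| ≤ B := by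
  -- adapted from `abs_wilsonTorusMean_le` of line OSLegsFromFemtoAndGap
  haveI := isProbabilityMeasure_wilsonMeasure (d := 4) (L := 2 * L + 1) r.ρ r.continuous β
  unfold wilsonTorusMean
  have h := norm_integral_le_of_norm_le_const (μ := wilsonMeasure (d := 4) (L := 2 * L + 1) r.ρ β)
    (f := fun U => (plaq r q).F (torusLift (2 * L + 1) U)) (C := B)
    (Eventually.of_forall fun U => by simpa [Real.norm_eq_abs] using hB q _)
  simpa [Real.norm_eq_abs] using h

/-- **The centred plaquette species are bounded by `2B`, uniformly in the step.** -/
theorem abs_Vq_le (r : LatticeRep G) {B : ℝ} (hB : ∀ (q : PlaqIdx) (V : LGConfig 4 G), |(plaq r q).F V| ≤ B)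
    (sch : SpeciesScheme (YMSpecies G)) (k : ℕ) (q : PlaqIdx) (V : LGConfig 4 G) : |Arp.Vq r sch k q V| ≤ 2 * B := by
  rw [two_mul]
  exact (abs_sub _ _).trans (add_le_add (hB q V) (abs_mean_plaq_le r hB _ _ q))

/-- The centred plaquette species are measurable. -/
theorem measurable_Vq (r : LatticeRep G) (sch : SpeciesScheme (YMSpecies G)) (k : ℕ) (q : PlaqIdx) :
    Measurable (Arp.Vq r sch k q) :=
  (plaq r q).measurable.sub measurable_const

omit [TopologicalSpace G] [IsTopologicalGroup G] [CompactSpace G] [BorelSpace G] in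
/-- **Sup bound of a lattice functional with a uniformly bounded string**: `‖lat W F U‖ ≤ C^p ∑ₓ ‖F(a_k x⃗)‖`. -/
theorem norm_lat_le (sch : SpeciesScheme (YMSpecies G)) (k : ℕ) {p : ℕ} {W : Fin p → LGConfig 4 G → ℝ} {C : ℝ}
    (hW : ∀ i V, |W i V| ≤ C) (F : 𝓢((Fin p → EuclideanSpace ℝ (Fin 4)), ℂ)) (U : GaugeConfig 4 (sch.side k) G) :
    ‖Arp.lat sch k W F U‖ ≤ C ^ p * ∑ x : Fin p → ↥(box 4 (sch.L k)), ‖F (fun i => sch.a k • siteToE (↑(x i) : Site 4))‖ := by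
  unfold Arp.lat
  rw [Finset.mul_sum]
  refine (norm_sum_le _ _).trans (Finset.sum_le_sum fun x _ => ?_)
  rw [norm_mul, norm_prod, mul_comm]
  refine mul_le_mul_of_nonneg_right ?_ (norm_nonneg _)
  calc ∏ i, ‖((W i (Literature.MathematicalPhysics.QuantumLattice.configShift (-(↑(x i) : Site 4)) (torusLift (sch.side k) U)) : ℝ) : ℂ)‖ ≤
        ∏ _i : Fin p, C :=
        Finset.prod_le_prod (fun i _ => norm_nonneg _) fun i _ => by
          rw [Complex.norm_real, Real.norm_eq_abs]; exact hW i _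
    _ = C ^ p := by simp

/-- The lattice functional of a plaquette string is bounded measurable. -/
theorem measurable_bdd_latVq (r : LatticeRep G) (sch : SpeciesScheme (YMSpecies G)) (k : ℕ) {p : ℕ}
    (q : Fin p → PlaqIdx) (F : 𝓢((Fin p → EuclideanSpace ℝ (Fin 4)), ℂ)) :
    Measurable (Arp.lat sch k (fun i => Arp.Vq r sch k (q i)) F) ∧
      ∃ C, ∀ U, ‖Arp.lat sch k (fun i => Arp.Vq r sch k (q i)) F U‖ ≤ C := by
  obtain ⟨B, -, hB⟩ := exists_plaq_bound r
  exact ⟨Arp.measurable_lat sch k (fun i => measurable_Vq r sch k (q i)) F,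
    Arp.exists_bound_lat sch k (fun i => ⟨2 * B, fun V => abs_Vq_le r hB sch k (q i) V⟩) F⟩

/-! ## The main terms: canonical plaquette-string distributions, bounded by `UUVB` -/

/-- **A pairing of two plaquette-string lattice functionals is a canonical string distribution** of the appended string
on the appended tensor. -/
theorem integral_latVq_mul_eq_canon (r : LatticeRep G) (sch : SpeciesScheme (YMSpecies G)) (k : ℕ) {p p' : ℕ}
    (q : Fin p → PlaqIdx) (q' : Fin p' → PlaqIdx) (F : 𝓢((Fin p → EuclideanSpace ℝ (Fin 4)), ℂ)) (H : 𝓢((Fin p' → EuclideanSpace ℝ (Fin 4)), ℂ)) :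
    ∫ U, Arp.lat sch k (fun i => Arp.Vq r sch k (q i)) F U * Arp.lat sch k (fun i => Arp.Vq r sch k (q' i)) H U
        ∂(μW r sch k) =
      canonDistribution r sch k (p + p') (fun i => plaq r (Fin.append q q' i)) (F.appendTensor H) := by
  rw [Arp.canonDistribution_eq_integral_lat]
  refine integral_congr_ae (Eventually.of_forall fun U => ?_)
  rw [← Arp.append_Vq, Arp.lat_append sch k _ _ (isAppendTensorOf_appendTensor F H)]

/-- **Main-term bound.** Under the `UUVB` inequality at step `k` (constants `s, α ≥ 0, β`), for locus-avoiding `F`, `G`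
whose supports are separated in time by a predicate, a translation vector `‖v‖ ≤ 1` and `n ≤ N`:
`‖∫ lat (Ṽ∘q) F · lat (Ṽ∘q') ((∂_v)^[n] G) dμ_k‖ ≤ α ((2p)!)^β 2^{2ps+1} |F|_{2ps} |G|_{2ps+N}`. -/
theorem norm_main_le (r : LatticeRep G) (sch : SpeciesScheme (YMSpecies G)) (k : ℕ) {p s : ℕ} {α β : ℝ} (hα : 0 ≤ α)
    (hU : ∀ (p' : ℕ) (σ : Fin p' → PlaqIdx) (K : 𝓢((Fin p' → EuclideanSpace ℝ (Fin 4)), ℂ)), IsOffDiagonal K →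
      ‖canonDistribution r sch k p' (fun i => plaq r (σ i)) K‖ ≤ α * (p'.factorial : ℝ) ^ β * schwartzNorm (p' * s) K)
    (q q' : Fin p → PlaqIdx) {F G : 𝓢((Fin p → EuclideanSpace ℝ (Fin 4)), ℂ)} (hF : AvoidsLocus F) (hG : AvoidsLocus G) (P : ℝ → Prop)
    (hFP : tsupport (F : (Fin p → EuclideanSpace ℝ (Fin 4)) → ℂ) ⊆ {x | ∀ j, P (x j 0)})
    (hGP : tsupport (G : (Fin p → EuclideanSpace ℝ (Fin 4)) → ℂ) ⊆ {y | ∀ j, ¬ P (y j 0)}) {v : Fin p → EuclideanSpace ℝ (Fin 4)} (hv : ‖v‖ ≤ 1) {n N : ℕ}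
    (hn : n ≤ N) :
    ‖∫ U, Arp.lat sch k (fun i => Arp.Vq r sch k (q i)) F U *
        Arp.lat sch k (fun i => Arp.Vq r sch k (q' i)) ((LineDeriv.lineDerivOp v)^[n] G) U ∂(μW r sch k)‖ ≤
      α * ((p + p).factorial : ℝ) ^ β * 2 ^ ((p + p) * s + 1) * schwartzNorm ((p + p) * s) F *
        schwartzNorm ((p + p) * s + N) G := by
  rw [integral_latVq_mul_eq_canon]
  refine (hU (p + p) (Fin.append q q') _ (isOffDiagonal_appendTensor_iterate hF hG P hFP hGP v n)).trans ?_
  set M := (p + p) * s with hM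
  set D : 𝓢((Fin p → EuclideanSpace ℝ (Fin 4)), ℂ) := (LineDeriv.lineDerivOp v)^[n] G with hD
  have h1 := schwartzNorm_appendTensor_le F D M
  have h2 : schwartzNorm M D ≤ schwartzNorm (M + N) G := by
    calc schwartzNorm M D ≤ ‖v‖ ^ n * schwartzNorm (M + n) G := schwartzNorm_iterate_lineDerivOp_le v G n M
      _ ≤ 1 * schwartzNorm (M + N) G :=
          mul_le_mul (pow_le_one₀ (norm_nonneg _) hv) (schwartzNorm_mono (by omega) G) (schwartzNorm_nonneg _ _)
            zero_le_one
      _ = schwartzNorm (M + N) G := one_mul _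
  have hfac : 0 ≤ α * ((p + p).factorial : ℝ) ^ β := mul_nonneg hα (Real.rpow_nonneg (Nat.cast_nonneg _) β)
  have hF0 := schwartzNorm_nonneg M F
  calc α * ((p + p).factorial : ℝ) ^ β * schwartzNorm ((p + p) * s) (F.appendTensor D)
      ≤ α * ((p + p).factorial : ℝ) ^ β * (2 ^ (M + 1) * schwartzNorm M F * schwartzNorm M D) :=
        mul_le_mul_of_nonneg_left h1 hfac
    _ ≤ α * ((p + p).factorial : ℝ) ^ β * (2 ^ (M + 1) * schwartzNorm M F * schwartzNorm (M + N) G) :=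
        mul_le_mul_of_nonneg_left (mul_le_mul_of_nonneg_left h2 (by positivity)) hfac
    _ = _ := by rw [hM]; ring

/-! ## The Taylor remainders: sup norms and counting -/

omit [Group G] [TopologicalSpace G] [IsTopologicalGroup G] [CompactSpace G] [MeasurableSpace G] [BorelSpace G] in
/-- **Pointwise decay of the Taylor remainder** of the translated test function `G(· − c)` along `−c`:
`‖(G(· − c) − ∑_{n<N} (n!)⁻¹ (∂_{−c})^[n] G)(y)‖ ≤ 4^M |(∂_{−c})^[N] G|_M (1 + ‖y‖)^{−M}` for `‖c‖ ≤ 1`. -/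
theorem norm_taylorRem_apply_le {p : ℕ} {c : Fin p → EuclideanSpace ℝ (Fin 4)} (hc : ‖c‖ ≤ 1) (N M : ℕ) (G : 𝓢((Fin p → EuclideanSpace ℝ (Fin 4)), ℂ))
    (y : Fin p → EuclideanSpace ℝ (Fin 4)) :
    ‖(SchwartzMap.compSubConstCLM ℂ c G -
        ∑ n ∈ Finset.range N, ((n.factorial : ℝ)⁻¹) • ((LineDeriv.lineDerivOp (-c))^[n] G : 𝓢((Fin p → EuclideanSpace ℝ (Fin 4)), ℂ))) y‖ ≤
      4 ^ M * schwartzNorm M ((LineDeriv.lineDerivOp (-c))^[N] G : 𝓢((Fin p → EuclideanSpace ℝ (Fin 4)), ℂ)) * ((1 + ‖y‖) ^ M)⁻¹ := by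
  show ‖G (y - c) - (∑ n ∈ Finset.range N, ((n.factorial : ℝ)⁻¹) •
    ((LineDeriv.lineDerivOp (-c))^[n] G : 𝓢((Fin p → EuclideanSpace ℝ (Fin 4)), ℂ))) y‖ ≤ _
  rw [sub_eq_add_neg y c]
  exact norm_sub_taylorSum_le_decay G y (-c) (by rwa [norm_neg]) N M

omit [Group G] [TopologicalSpace G] [IsTopologicalGroup G] [CompactSpace G] [MeasurableSpace G] [BorelSpace G] in
/-- **Lattice Riemann sum of the Taylor remainder**: `∑ₓ ‖(G(· − c) − Taylor polynomial)(a x⃗)‖ ≤ a^{−4p} (2(a+1))^{4p} 4^{8p} a^N |G|_{8p+N}`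
for `‖c‖ ≤ a ≤ 1`. -/
theorem sum_norm_taylorRem_le {p : ℕ} {a : ℝ} (ha : 0 < a) (ha1 : a ≤ 1) (S : ℕ) {c : Fin p → EuclideanSpace ℝ (Fin 4)} (hc : ‖c‖ ≤ a) (N : ℕ)
    (G : 𝓢((Fin p → EuclideanSpace ℝ (Fin 4)), ℂ)) :
    ∑ x : Fin p → ↥(box 4 S), ‖(SchwartzMap.compSubConstCLM ℂ c G -
        ∑ n ∈ Finset.range N, ((n.factorial : ℝ)⁻¹) • ((LineDeriv.lineDerivOp (-c))^[n] G : 𝓢((Fin p → EuclideanSpace ℝ (Fin 4)), ℂ)))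
        (fun i => a • siteToE (↑(x i) : Site 4))‖ ≤
      (a ^ (4 * p))⁻¹ * (2 * (a + 1)) ^ (4 * p) * (4 ^ (8 * p) * (a ^ N * schwartzNorm (8 * p + N) G)) := by
  have hc1 : ‖c‖ ≤ 1 := hc.trans ha1
  have hdL : schwartzNorm (8 * p) ((LineDeriv.lineDerivOp (-c))^[N] G : 𝓢((Fin p → EuclideanSpace ℝ (Fin 4)), ℂ)) ≤
      a ^ N * schwartzNorm (8 * p + N) G := by
    refine (schwartzNorm_iterate_lineDerivOp_le (-c) G N (8 * p)).trans ?_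
    rw [norm_neg]
    exact mul_le_mul_of_nonneg_right (pow_le_pow_left₀ (norm_nonneg _) hc N) (schwartzNorm_nonneg _ _)
  refine (sum_box_norm_le_of_decay ha S (fun y => (SchwartzMap.compSubConstCLM ℂ c G -
        ∑ n ∈ Finset.range N, ((n.factorial : ℝ)⁻¹) • ((LineDeriv.lineDerivOp (-c))^[n] G : 𝓢((Fin p → EuclideanSpace ℝ (Fin 4)), ℂ))) y)
    (mul_nonneg (by positivity) (schwartzNorm_nonneg _ _)) fun y => norm_taylorRem_apply_le hc1 N (8 * p) G y).trans ?_
  have h0 : 0 ≤ (a ^ (4 * p))⁻¹ * (2 * (a + 1)) ^ (4 * p) := by positivity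
  exact mul_le_mul_of_nonneg_left (mul_le_mul_of_nonneg_left hdL (by positivity)) h0

/-- **Remainder-type bound** (sup norm times sup norm on a probability space; bounded plaquettes and counting): for a bound
`B` on the plaquette species and any test function `R` of the second factor whose lattice Riemann sum is `≤ Yb`,
`‖∫ lat (Ṽ∘q) F · lat (Ṽ∘q') R dμ_k‖ ≤ [(2B)^p a^{−4p}(2(a+1))^{4p} 2^{8p} |F|_{8p}] · [(2B)^p Yb]`. -/
theorem norm_integral_latVq_mul_le (r : LatticeRep G) {B : ℝ} (hB0 : 0 ≤ B)
    (hB : ∀ (q : PlaqIdx) (V : LGConfig 4 G), |(plaq r q).F V| ≤ B) (sch : SpeciesScheme (YMSpecies G)) (k : ℕ) {p : ℕ}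
    (q q' : Fin p → PlaqIdx) (F R : 𝓢((Fin p → EuclideanSpace ℝ (Fin 4)), ℂ)) {Yb : ℝ}
    (hR : ∑ x : Fin p → ↥(box 4 (sch.L k)), ‖R (fun i => sch.a k • siteToE (↑(x i) : Site 4))‖ ≤ Yb) :
    ‖∫ U, Arp.lat sch k (fun i => Arp.Vq r sch k (q i)) F U *
        Arp.lat sch k (fun i => Arp.Vq r sch k (q' i)) R U ∂(μW r sch k)‖ ≤
      ((2 * B) ^ p * ((sch.a k ^ (4 * p))⁻¹ * (2 * (sch.a k + 1)) ^ (4 * p) *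
          (2 ^ (8 * p) * schwartzNorm (8 * p) F))) * ((2 * B) ^ p * Yb) := by
  have ha := sch.a_pos k
  have h2B : 0 ≤ 2 * B := mul_nonneg zero_le_two hB0
  set X := (2 * B) ^ p * ((sch.a k ^ (4 * p))⁻¹ * (2 * (sch.a k + 1)) ^ (4 * p) *
    (2 ^ (8 * p) * schwartzNorm (8 * p) F)) with hX
  have hXb : ∀ U, ‖Arp.lat sch k (fun i => Arp.Vq r sch k (q i)) F U‖ ≤ X := fun U =>
    (norm_lat_le sch k (fun i V => abs_Vq_le r hB sch k (q i) V) F U).trans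
      (mul_le_mul_of_nonneg_left (sum_norm_apply_smul_siteToE_le ha _ F) (pow_nonneg h2B _))
  have hYb : ∀ U, ‖Arp.lat sch k (fun i => Arp.Vq r sch k (q' i)) R U‖ ≤ (2 * B) ^ p * Yb := fun U =>
    (norm_lat_le sch k (fun i V => abs_Vq_le r hB sch k (q' i) V) R U).trans
      (mul_le_mul_of_nonneg_left hR (pow_nonneg h2B _))
  have hX0 : 0 ≤ X := (norm_nonneg _).trans (hXb fun _ => 1)
  have h := norm_integral_le_of_norm_le_const (μ := μW r sch k)
    (f := fun U => Arp.lat sch k (fun i => Arp.Vq r sch k (q i)) F U *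
      Arp.lat sch k (fun i => Arp.Vq r sch k (q' i)) R U) (C := X * ((2 * B) ^ p * Yb))
    (Eventually.of_forall fun U => by
      rw [norm_mul]; exact mul_le_mul (hXb U) (hYb U) (norm_nonneg _) hX0)
  rwa [probReal_univ, mul_one] at h

end Plaq

end Var

/-- **Registered anchor of this file** (closed form of `Var.integral_latVq_mul_eq_canon`, for the gate's `--supports` stub
check): a pairing of two plaquette-string lattice functionals is the canonical distribution of the appended plaquette
string on the appended tensor. -/
theorem varC_integral_latVq_mul_eq_canon :
    ∀ {G : Type} [Group G] [TopologicalSpace G] [IsTopologicalGroup G] [CompactSpace G] [MeasurableSpace G] [BorelSpace G]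
      (r : LatticeRep G) (sch : SpeciesScheme (YMSpecies G)) (k p p' : ℕ) (q : Fin p → PlaqIdx) (q' : Fin p' → PlaqIdx)
      (F : 𝓢((Fin p → EuclideanSpace ℝ (Fin 4)), ℂ)) (H : 𝓢((Fin p' → EuclideanSpace ℝ (Fin 4)), ℂ)),
      ∫ U, Arp.lat sch k (fun i => Arp.Vq r sch k (q i)) F U * Arp.lat sch k (fun i => Arp.Vq r sch k (q' i)) H U
          ∂(μW r sch k) =
        canonDistribution r sch k (p + p') (fun i => plaq r (Fin.append q q' i)) (F.appendTensor H) := by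
  intro G _ _ _ _ _ _ r sch k p p' q q' F H
  exact Var.integral_latVq_mul_eq_canon r sch k q q' F H

end Summit.QuantumFields.YangMills.Cruxes.ContinuumLimitOnTrajectory.TwoOrbitSynchronisation

end
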